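import Summits.MatrixMultiplication.OmegaCensus.SmallFormats.MatMul22nRankGF7Slack6PatList9
import Summits.MatrixMultiplication.OmegaCensus.SmallFormats.MatMul22nRankGF7Slots
import HarnessLib

/-!
# ω-census family (a): certificates of the normalised slack-6 patterns, decides part 9 of 14

Cell `pub-omega` (unit `pub-omega-tensor-g18`), topic `Summits/MatrixMultiplication/OmegaCensus` (sub-folder `SmallFormats`).
Framing (verbatim): lottery ticket; floor = certified bounds/negative ranges. HONEST FRAMING: machine-generated kernel checks
(`pub-omega-tensor-g18/code/py/gen6_cert18.py`, chunk-local form of `pub-omega-tensor-g17/code/gen6_sound.py`): for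
`16384 ≤ n < 18432` (written `n = 16384 + i`, `i < 2048`), `normCls6 n < 3692`, `normElt6 n < 336` and
`normVal6 n z = repVal6 (normCls6 n) (omAct7 (normElt6 n) z)` for all `z < 42`. Assembled in `MatMul22nRankGF7Slack6PatSound`.
Nothing here is progress on `ω`.
-/

namespace Summit.MatrixMultiplication.OmegaCensus.SmallFormats

set_option Elab.async false

set_option maxRecDepth 100000 in
set_option maxHeartbeats 400000000 in
/-- Certificates, patterns `n = 16384 + i`, `i < 2048`: class `< 3692`, element `< 336`, and the pattern is the representative moved by the element. -/
theorem normCert6_ok_9 : ∀ i : Fin 2048, normCls6 (16384 + i.val) < 3692 ∧ normElt6 (16384 + i.val) < 336 ∧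
    ∀ z : Fin 42, normVal6 (16384 + i.val) z.val = repVal6 (normCls6 (16384 + i.val)) (omAct7 (normElt6 (16384 + i.val)) z.val) := by
  decide +kernel

end Summit.MatrixMultiplication.OmegaCensus.SmallFormats
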